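import Summits.QuantumFields.YangMills.Theorems.UnitScaleTiltHistoryTailLaneTailV4Chi
import Summits.QuantumFields.YangMills.Theorems.AlphaInputsT3ACv4SeamWindowDL
import HarnessLib

/-!
# `UnitScaleTiltHistoryTailLaneTailV4ChiNested` — crux `HistoryTailL` (stmt-QuantumFields-19936): THE v4 DOOR IN THE DISPLAY OF RECORD — 19936 BY NAME from ⟨the registered 19200-side text
# `stub_thm1In8GlobalMin` at every odd `L > 1`⟩ ∧ ⟨NODE O's SEAM-FREE version-4 supplier rows: record sizes · collar · γ₀-tolerance · (O⁗χ) ONE nested-regular constrained minimiser selection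
# with its Sect. B–C χ-data⟩ (LEAD ★w1-19936 g3 B1 PLAN v3 (3): «NO seam row, NO κ»; ★★OWNER RULING g26-№14∕ACK 38 LF-2 CLOSED BY NAME) — cell `ym3-torus`, width seat ym-ust-19936-w3 (g5)

WHAT THE KERNEL NOW SAYS, end to end.  The v4 door ✓`HistoryTailLaneTailV4Chi.historyTailL_of_laneRecordsV4Chi` (P19, p620914) composed with the FLOOR-FREE nested supplier knits of
✓`AlphaInputsT3ACv4SeamWindowDL` (★w6-19936 g2, p620680, on ★w2-19936 g4's ✓`…v4SmallFactor71OfRecDL` and LEAD's `_dL` engine: the seam row (71)_sym DISCHARGED at every odd `L > 1`, the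
three window numerals folded into the record's `γ₀`-tolerance row):
* `historyTailL_of_pinnedPartsRecNestedV4Chi` — from ONE displayed predicate per odd `L > 1`, `AlphaInputsT3AC.PinnedPartsT3ACRecNestedV4Chi L` (✓`…v4RecordNested`: (T) `Thm1GlobalMinAt` · the
  record sizes · collar `7L + 3 ≤ M₁` · `γ₀ ≤ ((φ(C68)∕(b₀Q₀))²)²` · (O⁗χ) for some pinned [7]-family one NESTED-REGULAR constrained selection with `DataRowsT3NestedChiSel` — NO seam conjunct,
  NO comb letter, NO (FL), NO collar numeral, NO block-size floor), through ✓`alphaInputsT3ACv4RecChi_of_pinnedPartsRecNestedV4Chi_dL`;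
* ★★★ `historyTailL_of_thm1In8_nestedDataRows_dL` — THE ONE-SUPPLIER DOOR OF RECORD: hypotheses VERBATIM those of ✓`HistoryTailSelSupplier.laneRecordsV4Chi_of_thm1In8_nestedDataRows_dL`
  (`hT8` = the 19200-side registered text; `hrows` = NODE O's rows at a floor `B₀` and a box `(0, A₀] × (0, A₁]` per odd `L`), conclusion the item BY NAME.
HONEST FRAMING.  Two one-line compositions of landed theorems; `PinnedPartsT3ACRecNestedV4Chi`, `hT8`, `hrows` are HYPOTHESIS SCHEMAS (never asserted) — «19936 PROVED MODULO ⟨T8⟩ ∧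
⟨NODE O's seam-free v4 rows⟩», not a proof of the crux; nothing of [Balaban1985UV3]'s cluster expansion or [Balaban1985Variational] Thm 1 is proved; count-neutral helper
(`--supports stmt-QuantumFields-19936`); registry untouched (v5p10 is LEAD's crux-workfile act).  YM₃ on the three-torus is rung R3 of the programme, not the Clay problem; no claim about
d = 4, infinite volume, or a mass gap.
[cite: Balaban1985UV3, (5) p.256, (7) p.257, (40)–(42) p.266, (47) p.267, (67)–(71) p.273 and Thm 2 p.272; Balaban1985Variational, (2)–(3) p.278, Thm 1 (6)–(8) pp.278–279; King1986, (3.12) p.657]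
-/

set_option autoImplicit false

noncomputable section

namespace Summit.QuantumFields.YangMills.Theorems.HistoryTailLaneTailV4Chi
open MeasureTheory Set
open scoped Matrix.Norms.L2Operator
open Literature.MathematicalPhysics.QuantumFieldTheory.Balaban1983to89
open Literature.MathematicalPhysics.QuantumFieldTheory.Balaban1983to89.T3ContinuumYM3Torus
open Literature.MathematicalPhysics.QuantumFieldTheory.Balaban1983to89.T3PrintedMinimiserExistence (Thm1GlobalMinAt)
open Literature.MathematicalPhysics.QuantumFieldTheory.Balaban1983to89.T3LowerAlongMinimisersSplit (MinimisersIn8At)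
open Literature.MathematicalPhysics.QuantumFieldTheory.Balaban1983to89.ExpMeanLog (deltaSU)
open Literature.MathematicalPhysics.QuantumFieldTheory.Balaban1985CMP102.Setting
open Summit.QuantumFields.Balaban3D.Carriers
open Summit.QuantumFields.Balaban3D.Proofs.Primitives
open Summit.QuantumFields.Balaban3D.Proofs.Thresholds (Q0 Q0_pos)
open B7Prop2Explicit (C0 C0_pos)
open Summit.QuantumFields.YangMills.Theorems.HistoryTailSelSupplier (laneRecordsV4Chi_of_thm1In8_nestedDataRows_dL)

/-- **`HistoryTailL` FROM THE SEAM-FREE VERSION-4 NESTED DISPLAY, every odd `L > 1` (no block-size floor)**: if the displayed predicate `PinnedPartsT3ACRecNestedV4Chi L` holds for every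
odd `L > 1` — (T) + record sizes + collar + γ₀-tolerance + (O⁗χ) one nested-regular constrained selection with its χ-data — then the crux holds
(`historyTailL_of_laneRecordsV4Chi ∘ alphaInputsT3ACv4RecChi_of_pinnedPartsRecNestedV4Chi_dL`). [cite: Balaban1985UV3, (5) p.256, (47) p.267 and (71) p.273; Balaban1985Variational, Thm 1 (8) p.279] -/
theorem historyTailL_of_pinnedPartsRecNestedV4Chi
    (h : ∀ L : ℕ, Odd L → 1 < L → AlphaInputsT3AC.PinnedPartsT3ACRecNestedV4Chi L) :
    Summit.QuantumFields.YangMills.Theses.UnitScaleTilt.HistoryTailL :=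
  historyTailL_of_laneRecordsV4Chi fun L hLo hL => alphaInputsT3ACv4RecChi_of_pinnedPartsRecNestedV4Chi_dL (h L hLo hL)

/-- ★★★ **THE ONE-SUPPLIER DOOR OF RECORD — `HistoryTailL` ⇐ ⟨`stub_thm1In8GlobalMin`'s TEXT at every odd `L > 1`⟩ ∧ ⟨NODE O's SEAM-FREE v4 rows⟩**: the hypotheses are VERBATIM those of
`HistoryTailSelSupplier.laneRecordsV4Chi_of_thm1In8_nestedDataRows_dL` (per odd `L` a floor `B₀` and a box `(0, A₀] × (0, A₁]` on which, for every `φ > 0` on `(0, ∞)`, a record with the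
three `C68`-sizes, the collar `7L + 3 ≤ M₁`, the tolerance `γ₀ ≤ ((φ(C68)∕(b₀Q₀))²)²` and, per family∕`(γ, K)`, ONE nested-regular constrained minimiser selection with its Sect. B–C χ-data is
served); the conclusion is the item stmt-QuantumFields-19936 BY NAME.  CONDITIONAL — nothing of the two displayed inputs is proved here.
[cite: Balaban1985UV3, (5) p.256, (47) p.267, (67)–(71) p.273 and Thm 2 p.272; Balaban1985Variational, Thm 1 (6)–(8) pp.278–279] -/
theorem historyTailL_of_thm1In8_nestedDataRows_dL
    (hT8 : ∀ L : ℕ, Odd L → 1 < L → ∃ a₀ a₁ B₃ : ℝ, 0 < a₀ ∧ 0 < a₁ ∧ 0 < B₃ ∧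
      Thm1GlobalMinAt L a₀ a₁ B₃ ∧ MinimisersIn8At L a₀ a₁ B₃)
    (hrows : ∀ L : ℕ, Odd L → 1 < L → ∃ (B₀ A₀ A₁ : ℝ), 0 < A₀ ∧ 0 < A₁ ∧
      ∀ (B a₀ a₁ : ℝ), B₀ ≤ B → 1 ≤ 2 * B → 0 < a₀ → a₀ ≤ A₀ → 0 < a₁ → a₁ ≤ A₁ → B * a₁ ≤ a₀ →
        (143 * ((((3 + 4 : ℕ) : ℝ)) ^ 2 / 4) ^ 2) * (2 * (B * a₁)) ≤ 1 / 3 →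
        2 * (2 * (B * a₁)) ≤ 2 * deltaSU (Fin 2) / (((3 + 4) * L : ℕ) : ℝ) ^ 2 →
        Thm1GlobalMinAt L a₀ a₁ B →
        ∃ (b₁ p₁ : ℝ), ∀ (b₀ p₀ : ℝ), b₁ ≤ b₀ → p₁ ≤ p₀ → ∀ (φ : ℝ → ℝ), (∀ x : ℝ, 0 < x → 0 < φ x) →
          ∃ 𝔠 : AlphaConsts L (suGroupModel 2).N, 𝔠.b₀ = b₀ ∧ 𝔠.p₀ = p₀ ∧ 𝔠.B₃ = B ∧
            4 * 𝔠.B₃ * (L : ℝ) ^ 2 * avgWindowFactor L ≤ 𝔠.C68 ∧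
            Real.exp (𝔠.p₀ - 1) ≤ 3 * C0 3 * 𝔠.C68 * (𝔠.b₀ * Q0 𝔠.p₀) ∧
            (𝔠.b₀ * Q0 𝔠.p₀) * (2 * (L : ℝ) ^ 2 * avgWindowFactor L) ^ 2 ≤ 3 * C0 3 * 𝔠.C68 * a₁ ^ 2 ∧
            7 * L + 3 ≤ 𝔠.M₁ ∧
            𝔠.gamma0 ≤ ((φ 𝔠.C68 / (𝔠.b₀ * Q0 𝔠.p₀)) ^ 2) ^ 2 ∧
            ∀ (F : T3Family) (hF : F.L = L) (γ : ℝ) (hγ : 0 < γ) (hγ1 : γ ≤ (min (hF ▸ 𝔠).gamma0 1) ^ 2) (K : ℕ),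
              (∃ Ut : (k : ℕ) → GaugeField (F.P K) k (Matrix.specialUnitaryGroup (Fin 2) ℂ) →
                  GaugeField (F.P K) 0 (Matrix.specialUnitaryGroup (Fin 2) ℂ),
                AlphaInputsT3AC.TrivMinimiserRowsT3 F (hF ▸ 𝔠) γ hγ hγ1 a₀ a₁ K Ut) →
              ∃ Ut : (k : ℕ) → GaugeField (F.P K) k (Matrix.specialUnitaryGroup (Fin 2) ℂ) →
                  GaugeField (F.P K) 0 (Matrix.specialUnitaryGroup (Fin 2) ℂ),
                AlphaInputsT3AC.TrivMinimiserRowsT3 F (hF ▸ 𝔠) γ hγ hγ1 a₀ a₁ K Ut ∧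
                  AlphaInputsT3AC.DataRowsT3NestedChiSel F (hF ▸ 𝔠) γ hγ hγ1 K Ut) :
    Summit.QuantumFields.YangMills.Theses.UnitScaleTilt.HistoryTailL :=
  historyTailL_of_laneRecordsV4Chi (laneRecordsV4Chi_of_thm1In8_nestedDataRows_dL hT8 hrows)

/-! ## v1.1 — the (T)-input weakened: `MinimisersIn8At` is idle on the nested v4 path (LEAD ★w1-19936 g3 09:33:09Z; ★w5-19936 g4 LOCATE) -/

open Summit.QuantumFields.YangMills.Theorems.HistoryTailSelSupplier (pinnedPartsT3ACRecNestedV4Chi_of_thm1_rows) in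
/-- ★★★ **THE ONE-SUPPLIER DOOR OF RECORD WITH THE (T)-INPUT WEAKENED TO [Balaban1985Variational] Thm 1 ALONE**: `historyTailL_of_thm1In8_nestedDataRows_dL`'s text with the conjunct
`MinimisersIn8At L a₀ a₁ B₃` of `hT8` DROPPED — on the nested v4 path only `Thm1GlobalMinAt` is read (✓`pinnedPartsT3ACRecNestedV4Chi_of_thm1_rows` takes `∃ a₀ a₁ B₃, … ∧ Thm1GlobalMinAt L a₀ a₁ B₃`;
the (8)-rows enter NODE O's `hrows` through `TrivMinimiserRowsT3`, not through `hT`).  So 19936 BY NAME ⇐ ⟨(T): a global regular minimiser exists at every odd `L > 1` for some window⟩ ∧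
⟨NODE O's seam-free v4 rows⟩.  CONDITIONAL — nothing of the two displayed inputs is proved here. [cite: Balaban1985Variational, Thm 1 (6)–(8) pp.278–279; Balaban1985UV3, (5) p.256, (47) p.267, (71) p.273 and Thm 2 p.272] -/
theorem historyTailL_of_thm1GlobalMin_nestedDataRows_dL
    (hT : ∀ L : ℕ, Odd L → 1 < L → ∃ a₀ a₁ B₃ : ℝ, 0 < a₀ ∧ 0 < a₁ ∧ 0 < B₃ ∧ Thm1GlobalMinAt L a₀ a₁ B₃)
    (hrows : ∀ L : ℕ, Odd L → 1 < L → ∃ (B₀ A₀ A₁ : ℝ), 0 < A₀ ∧ 0 < A₁ ∧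
      ∀ (B a₀ a₁ : ℝ), B₀ ≤ B → 1 ≤ 2 * B → 0 < a₀ → a₀ ≤ A₀ → 0 < a₁ → a₁ ≤ A₁ → B * a₁ ≤ a₀ →
        (143 * ((((3 + 4 : ℕ) : ℝ)) ^ 2 / 4) ^ 2) * (2 * (B * a₁)) ≤ 1 / 3 →
        2 * (2 * (B * a₁)) ≤ 2 * deltaSU (Fin 2) / (((3 + 4) * L : ℕ) : ℝ) ^ 2 →
        Thm1GlobalMinAt L a₀ a₁ B →
        ∃ (b₁ p₁ : ℝ), ∀ (b₀ p₀ : ℝ), b₁ ≤ b₀ → p₁ ≤ p₀ → ∀ (φ : ℝ → ℝ), (∀ x : ℝ, 0 < x → 0 < φ x) →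
          ∃ 𝔠 : AlphaConsts L (suGroupModel 2).N, 𝔠.b₀ = b₀ ∧ 𝔠.p₀ = p₀ ∧ 𝔠.B₃ = B ∧
            4 * 𝔠.B₃ * (L : ℝ) ^ 2 * avgWindowFactor L ≤ 𝔠.C68 ∧
            Real.exp (𝔠.p₀ - 1) ≤ 3 * C0 3 * 𝔠.C68 * (𝔠.b₀ * Q0 𝔠.p₀) ∧
            (𝔠.b₀ * Q0 𝔠.p₀) * (2 * (L : ℝ) ^ 2 * avgWindowFactor L) ^ 2 ≤ 3 * C0 3 * 𝔠.C68 * a₁ ^ 2 ∧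
            7 * L + 3 ≤ 𝔠.M₁ ∧
            𝔠.gamma0 ≤ ((φ 𝔠.C68 / (𝔠.b₀ * Q0 𝔠.p₀)) ^ 2) ^ 2 ∧
            ∀ (F : T3Family) (hF : F.L = L) (γ : ℝ) (hγ : 0 < γ) (hγ1 : γ ≤ (min (hF ▸ 𝔠).gamma0 1) ^ 2) (K : ℕ),
              (∃ Ut : (k : ℕ) → GaugeField (F.P K) k (Matrix.specialUnitaryGroup (Fin 2) ℂ) →
                  GaugeField (F.P K) 0 (Matrix.specialUnitaryGroup (Fin 2) ℂ),
                AlphaInputsT3AC.TrivMinimiserRowsT3 F (hF ▸ 𝔠) γ hγ hγ1 a₀ a₁ K Ut) →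
              ∃ Ut : (k : ℕ) → GaugeField (F.P K) k (Matrix.specialUnitaryGroup (Fin 2) ℂ) →
                  GaugeField (F.P K) 0 (Matrix.specialUnitaryGroup (Fin 2) ℂ),
                AlphaInputsT3AC.TrivMinimiserRowsT3 F (hF ▸ 𝔠) γ hγ hγ1 a₀ a₁ K Ut ∧
                  AlphaInputsT3AC.DataRowsT3NestedChiSel F (hF ▸ 𝔠) γ hγ hγ1 K Ut) :
    Summit.QuantumFields.YangMills.Theses.UnitScaleTilt.HistoryTailL :=
  historyTailL_of_laneRecordsV4Chi fun L hLo hL => by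
    obtain ⟨B₀, A₀, A₁, hA₀, hA₁, h⟩ := hrows L hLo hL
    exact alphaInputsT3ACv4RecChi_of_pinnedPartsRecNestedV4Chi_dL
      (pinnedPartsT3ACRecNestedV4Chi_of_thm1_rows hL (hT L hLo hL) hA₀ hA₁ h)

end Summit.QuantumFields.YangMills.Theorems.HistoryTailLaneTailV4Chi

end
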